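import Summits.ValiantsHypothesis.ValiantsHypothesis.Theorems.KPlusLogSqLawTropicalBTwoTermTie
import Summits.ValiantsHypothesis.ValiantsHypothesis.Theorems.KPlusLogSqLawTropicalBVertexCount

/-!
# Route «KPlusLogSqLaw», crux `TropicalB` (stmt-ValiantsHypothesis-19771) — the RIGIDITY LAW («garbage is necessary»):
# if EVERY present term of a design is a unique optimum at some slope, any two present terms differ on exactly ONE exchange orbit

HONEST FRAMING.  Helper file (cell `pub-symmetroid`, seat val-sym-trop-p1 g32, 2026-08-29) `--supports` the crux
`Summit.ValiantsHypothesis.ValiantsHypothesis.Theses.KPlusLogSqLaw.TropicalB` (item `stmt-ValiantsHypothesis-19771`, registered stubs `stub_tropThin` /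
`stub_tropFat` of `Cruxes/TropicalB/Lines/birth.lean`).  An all-design STRUCTURE LAW (every format, exponents, valuations, support), def-free; it bounds no
census row and asserts nothing about `TropicalB` in its window, `WeakLifting`, DoorA26 / DoorA34, `MatrixDescartes` (stmt-ValiantsHypothesis-18050) or VP ≠ VNP.

A design `(d, v, ε)` is RIGID if every present term (`termSign ε q ≠ 0`) is the unique optimum (`IsDominant`) at some integer slope — the situation of the
cell's cleanest lower-bound certificates (…TropicalBCoupledRegisters: «every present term is one of the (N+1)² states»; the rigid form
`HullCriterion.isDominant_of_rigid` of this seat's hull criterion), in which no «garbage» term has to be dominated.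

* `RigidityLaw.not_split` — **RIGIDITY LAW**: in a rigid design, two dominant terms `(σ₁, λ₁)` (at `θ₁`) and `(σ₂, λ₂)` (at `θ₂`) never differ both on an
  invariant column set `T` of the quotient `σ₁⁻¹σ₂` and off it.  Proof: the two EXCHANGED terms (`σ₂, λ₂` on `T`, `σ₁, λ₁` off `T` and vice versa) use
  only present incidences, so they are present, so — by rigidity — dominant at some slopes `θ₃, θ₄`; the cyclewise exchange law
  (`sum_d_lt_of_isDominant_split` / `_exchange`, …TropicalCycleMonotone) applied to the pair (original terms) makes the exponent mass rise on `T` AND on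
  `Tᶜ` from the earlier to the later, and applied to the pair (exchanged terms) — whose exchange along `T` gives back the originals — makes it fall on
  `T` or on `Tᶜ`; `θ₃ = θ₄` is excluded by uniqueness (`eq_of_isDominant_of_isDominant`).  (Valuation-free: the four terms form a modular square, cf.
  `ConvexPosition.sidon`.)
* `RigidityLaw.sameCycle` — hence all columns where two dominant terms of a rigid design differ lie on ONE cycle of `σ₁⁻¹σ₂`;
  `RigidityLaw.eq_of_apply_eq` — and if they differ in class at a column fixed by the quotient, that column is their only difference
  (terms of a rigid design sharing their permutation differ in at most one cell).
READING.  Compare the UNIT-STEP LAW (`TransferLaw.UnitStep.not_split`, trop-p5 g17: the same conclusion for ANY design when the two slopes differ by ≤ 1):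
rigidity buys single-cycle differences at EVERY slope distance.  Consequences (located / paper, memo REPORT-g32 §8): the permutations of a rigid design form
a family in which every quotient is a single cycle — the clique number of that Cayley graph on `S_m` is 2, 6, 6, 13 for `m = 2..5` (exact) and ≥ 18, ≥ 19 for
`m = 6, 7` (greedy), apparently polynomial — and the terms over one permutation vary a single cell (≤ K of them); so super-polynomial chains need DOMINATED
PRESENT TERMS («garbage»), as the kernel 6-cube (81 incidences, 64 states) and every counting-tight column have.  [this seat; the exchange lemma is the cell's]
-/

set_option linter.dupNamespace false
set_option autoImplicit false

namespace Summit.ValiantsHypothesis.ValiantsHypothesis.Theorems.KPlusLogSqLaw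

open Summit.ValiantsHypothesis.ValiantsHypothesis.Theorems.MatrixDescartes.Negative
open scoped BigOperators

namespace RigidityLaw

variable {m K : ℕ} (d : Fin K → ℕ) (v ε : Fin m → Fin m → Fin K → ℤ)

/-- a term all of whose incidences are present is present. [folklore] -/
theorem termSign_ne_zero_of_entries {σ : Equiv.Perm (Fin m)} {l : Fin m → Fin K} (h : ∀ b, ε (σ b) b (l b) ≠ 0) :
    termSign ε (σ, l) ≠ 0 := by
  unfold termSign
  refine mul_ne_zero ?_ (Finset.prod_ne_zero_iff.mpr fun b _ => h b)
  exact_mod_cast (Equiv.Perm.sign σ).ne_zero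

/-- the rigidity law when the first term is dominant at the smaller slope. -/
theorem not_split_lt (hrig : ∀ q : Equiv.Perm (Fin m) × (Fin m → Fin K), termSign ε q ≠ 0 → ∃ θ : ℤ, IsDominant d v ε θ q)
    {θ₁ θ₂ : ℤ} (hθ : θ₁ < θ₂) {σ₁ σ₂ : Equiv.Perm (Fin m)} {l₁ l₂ : Fin m → Fin K}
    (h₁ : IsDominant d v ε θ₁ (σ₁, l₁)) (h₂ : IsDominant d v ε θ₂ (σ₂, l₂)) (T : Finset (Fin m))
    (hT : ∀ b, (σ₁⁻¹ * σ₂) b ∈ T ↔ b ∈ T) (hin : ∃ b ∈ T, σ₁ b ≠ σ₂ b ∨ l₁ b ≠ l₂ b)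
    (hout : ∃ b ∉ T, σ₁ b ≠ σ₂ b ∨ l₁ b ≠ l₂ b) : False := by
  classical
  obtain ⟨hA, hB⟩ := sum_d_lt_of_isDominant_split d v ε hθ h₁ h₂ T hT hin hout
  obtain ⟨πT, hπT, hπT', hπTmem⟩ := exists_perm_restrict (σ₁⁻¹ * σ₂) T hT
  -- the exchanged terms and their pointwise description
  set r₁ : Equiv.Perm (Fin m) × (Fin m → Fin K) := (σ₁ * πT, fun b => if b ∈ T then l₂ b else l₁ b) with hr₁
  set r₂ : Equiv.Perm (Fin m) × (Fin m → Fin K) := (σ₂ * πT⁻¹, fun b => if b ∈ T then l₁ b else l₂ b) with hr₂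
  have r₁T : ∀ b ∈ T, r₁.1 b = σ₂ b ∧ r₁.2 b = l₂ b := by
    intro b hb
    refine ⟨?_, by simp [hr₁, hb]⟩
    show σ₁ (πT b) = σ₂ b
    rw [hπT b hb]; simp
  have r₁T' : ∀ b ∉ T, r₁.1 b = σ₁ b ∧ r₁.2 b = l₁ b := by
    intro b hb
    refine ⟨?_, by simp [hr₁, hb]⟩
    show σ₁ (πT b) = σ₁ b
    rw [hπT' b hb]
  have r₂T : ∀ b ∈ T, r₂.1 b = σ₁ b ∧ r₂.2 b = l₁ b := by
    intro b hb
    refine ⟨?_, by simp [hr₂, hb]⟩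
    show σ₂ (πT⁻¹ b) = σ₁ b
    have hc : πT⁻¹ b ∈ T := (hπTmem (πT⁻¹ b)).1 (by simpa using hb)
    have hπc : (σ₁⁻¹ * σ₂) (πT⁻¹ b) = b := by rw [← hπT _ hc]; simp
    rw [Equiv.Perm.mul_apply, Equiv.Perm.inv_eq_iff_eq] at hπc
    exact hπc
  have r₂T' : ∀ b ∉ T, r₂.1 b = σ₂ b ∧ r₂.2 b = l₂ b := by
    intro b hb
    refine ⟨?_, by simp [hr₂, hb]⟩
    show σ₂ (πT⁻¹ b) = σ₂ b
    have : πT⁻¹ b = b := by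
      rw [Equiv.Perm.inv_eq_iff_eq]
      exact (hπT' b hb).symm
    rw [this]
  -- both exchanged terms are present (their incidences are incidences of the two dominant terms), hence dominant somewhere
  have pres₁ : termSign ε r₁ ≠ 0 := by
    rw [show r₁ = (r₁.1, r₁.2) from rfl]
    refine termSign_ne_zero_of_entries ε fun b => ?_
    by_cases hb : b ∈ T
    · rw [(r₁T b hb).1, (r₁T b hb).2]; exact CyclePotential.entry_present ε h₂.1 b
    · rw [(r₁T' b hb).1, (r₁T' b hb).2]; exact CyclePotential.entry_present ε h₁.1 b
  have pres₂ : termSign ε r₂ ≠ 0 := by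
    rw [show r₂ = (r₂.1, r₂.2) from rfl]
    refine termSign_ne_zero_of_entries ε fun b => ?_
    by_cases hb : b ∈ T
    · rw [(r₂T b hb).1, (r₂T b hb).2]; exact CyclePotential.entry_present ε h₁.1 b
    · rw [(r₂T' b hb).1, (r₂T' b hb).2]; exact CyclePotential.entry_present ε h₂.1 b
  obtain ⟨θ₃, h₃⟩ := hrig r₁ pres₁
  obtain ⟨θ₄, h₄⟩ := hrig r₂ pres₂
  obtain ⟨b₀, hb₀T, hb₀⟩ := hin
  obtain ⟨b₁, hb₁T, hb₁⟩ := hout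
  rcases lt_trichotomy θ₃ θ₄ with hlt | heq | hgt
  · -- `θ₃ < θ₄`: exchanging `T` between `r₁, r₂` gives back the original terms; the mass on `T` would fall
    have key := sum_d_lt_of_isDominant_exchange d v ε hlt h₃ h₄ T (r₁ := (σ₁, l₁)) (r₂ := (σ₂, l₂))
      (fun b hb => ⟨(r₂T b hb).1.symm, (r₂T b hb).2.symm⟩) (fun b hb => ⟨(r₁T' b hb).1.symm, (r₁T' b hb).2.symm⟩)
      (fun b hb => ⟨(r₁T b hb).1.symm, (r₁T b hb).2.symm⟩) (fun b hb => ⟨(r₂T' b hb).1.symm, (r₂T' b hb).2.symm⟩)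
      (by
        intro h
        have e1 : σ₁ b₀ = r₁.1 b₀ := by rw [← h]
        have e2 : l₁ b₀ = r₁.2 b₀ := by rw [← h]
        rw [(r₁T b₀ hb₀T).1] at e1
        rw [(r₁T b₀ hb₀T).2] at e2
        rcases hb₀ with h' | h'
        · exact h' e1
        · exact h' e2)
    have e : ∑ b ∈ T, (d (r₁.2 b) : ℤ) = ∑ b ∈ T, (d (l₂ b) : ℤ) := Finset.sum_congr rfl fun b hb => by rw [(r₁T b hb).2]
    have e' : ∑ b ∈ T, (d (r₂.2 b) : ℤ) = ∑ b ∈ T, (d (l₁ b) : ℤ) := Finset.sum_congr rfl fun b hb => by rw [(r₂T b hb).2]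
    rw [e, e'] at key
    exact absurd hA (not_lt.mpr key.le)
  · -- `θ₃ = θ₄`: the two exchanged terms coincide, so the original terms agree on `T`
    subst heq
    have hrr : r₁ = r₂ := eq_of_isDominant_of_isDominant d v ε h₃ h₄
    have e1 : r₁.1 b₀ = r₂.1 b₀ := by rw [hrr]
    have e2 : r₁.2 b₀ = r₂.2 b₀ := by rw [hrr]
    rw [(r₁T b₀ hb₀T).1, (r₂T b₀ hb₀T).1] at e1
    rw [(r₁T b₀ hb₀T).2, (r₂T b₀ hb₀T).2] at e2
    rcases hb₀ with h' | h'
    · exact h' e1.symm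
    · exact h' e2.symm
  · -- `θ₄ < θ₃`: exchange `Tᶜ` between `r₂, r₁`; the mass on `Tᶜ` would fall
    have key := sum_d_lt_of_isDominant_exchange d v ε hgt h₄ h₃ Tᶜ (r₁ := (σ₁, l₁)) (r₂ := (σ₂, l₂))
      (fun b hb => ⟨(r₁T' b (Finset.mem_compl.mp hb)).1.symm, (r₁T' b (Finset.mem_compl.mp hb)).2.symm⟩)
      (fun b hb => ⟨(r₂T b (by simpa using hb)).1.symm, (r₂T b (by simpa using hb)).2.symm⟩)
      (fun b hb => ⟨(r₂T' b (Finset.mem_compl.mp hb)).1.symm, (r₂T' b (Finset.mem_compl.mp hb)).2.symm⟩)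
      (fun b hb => ⟨(r₁T b (by simpa using hb)).1.symm, (r₁T b (by simpa using hb)).2.symm⟩)
      (by
        intro h
        have e1 : σ₁ b₁ = r₂.1 b₁ := by rw [← h]
        have e2 : l₁ b₁ = r₂.2 b₁ := by rw [← h]
        rw [(r₂T' b₁ hb₁T).1] at e1
        rw [(r₂T' b₁ hb₁T).2] at e2
        rcases hb₁ with h' | h'
        · exact h' e1
        · exact h' e2)
    have e : ∑ b ∈ Tᶜ, (d (r₂.2 b) : ℤ) = ∑ b ∈ Tᶜ, (d (l₂ b) : ℤ) :=
      Finset.sum_congr rfl fun b hb => by rw [(r₂T' b (Finset.mem_compl.mp hb)).2]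
    have e' : ∑ b ∈ Tᶜ, (d (r₁.2 b) : ℤ) = ∑ b ∈ Tᶜ, (d (l₁ b) : ℤ) :=
      Finset.sum_congr rfl fun b hb => by rw [(r₁T' b (Finset.mem_compl.mp hb)).2]
    rw [e, e'] at key
    exact absurd hB (not_lt.mpr key.le)

/-- **RIGIDITY LAW.**  In a rigid design (every present term is a unique optimum at some integer slope), two dominant terms never differ both
on an invariant column set of their quotient and off it. [this seat] -/
theorem not_split (hrig : ∀ q : Equiv.Perm (Fin m) × (Fin m → Fin K), termSign ε q ≠ 0 → ∃ θ : ℤ, IsDominant d v ε θ q)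
    {θ₁ θ₂ : ℤ} {σ₁ σ₂ : Equiv.Perm (Fin m)} {l₁ l₂ : Fin m → Fin K}
    (h₁ : IsDominant d v ε θ₁ (σ₁, l₁)) (h₂ : IsDominant d v ε θ₂ (σ₂, l₂)) (T : Finset (Fin m))
    (hT : ∀ b, (σ₁⁻¹ * σ₂) b ∈ T ↔ b ∈ T) (hin : ∃ b ∈ T, σ₁ b ≠ σ₂ b ∨ l₁ b ≠ l₂ b)
    (hout : ∃ b ∉ T, σ₁ b ≠ σ₂ b ∨ l₁ b ≠ l₂ b) : False := by
  rcases lt_trichotomy θ₁ θ₂ with hlt | heq | hgt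
  · exact not_split_lt d v ε hrig hlt h₁ h₂ T hT hin hout
  · subst heq
    have h := eq_of_isDominant_of_isDominant d v ε h₁ h₂
    obtain ⟨b, _, hb⟩ := hin
    rcases hb with h' | h'
    · exact h' (by rw [show σ₁ = σ₂ from congrArg Prod.fst h])
    · exact h' (by rw [show l₁ = l₂ from congrArg Prod.snd h])
  · -- swap the roles of the two terms: `T` is invariant under the inverse quotient as well
    have hT' : ∀ b, (σ₂⁻¹ * σ₁) b ∈ T ↔ b ∈ T := by
      intro b
      have h := hT ((σ₂⁻¹ * σ₁) b)
      have e : (σ₁⁻¹ * σ₂) ((σ₂⁻¹ * σ₁) b) = b := by simp [Equiv.Perm.mul_apply]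
      rw [e] at h
      exact h.symm
    exact not_split_lt d v ε hrig hgt h₂ h₁ T hT'
      (by obtain ⟨b, hb, h⟩ := hin; exact ⟨b, hb, h.imp Ne.symm Ne.symm⟩)
      (by obtain ⟨b, hb, h⟩ := hout; exact ⟨b, hb, h.imp Ne.symm Ne.symm⟩)

/-- **single cycle**: in a rigid design all columns where two dominant terms differ (in row or class) lie on ONE cycle of the quotient
`σ₁⁻¹σ₂`. [this seat] -/
theorem sameCycle (hrig : ∀ q : Equiv.Perm (Fin m) × (Fin m → Fin K), termSign ε q ≠ 0 → ∃ θ : ℤ, IsDominant d v ε θ q)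
    {θ₁ θ₂ : ℤ} {σ₁ σ₂ : Equiv.Perm (Fin m)} {l₁ l₂ : Fin m → Fin K}
    (h₁ : IsDominant d v ε θ₁ (σ₁, l₁)) (h₂ : IsDominant d v ε θ₂ (σ₂, l₂)) {b b' : Fin m}
    (hb : σ₁ b ≠ σ₂ b ∨ l₁ b ≠ l₂ b) (hb' : σ₁ b' ≠ σ₂ b' ∨ l₁ b' ≠ l₂ b') :
    (σ₁⁻¹ * σ₂).SameCycle b b' := by
  classical
  by_contra hnot
  set π := σ₁⁻¹ * σ₂ with hπ
  let T : Finset (Fin m) := Finset.univ.filter fun c => π.SameCycle b c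
  have hT : ∀ c, π c ∈ T ↔ c ∈ T := by
    intro c
    simp only [T, Finset.mem_filter, Finset.mem_univ, true_and]
    exact Equiv.Perm.sameCycle_apply_right
  exact not_split d v ε hrig h₁ h₂ T hT
    ⟨b, Finset.mem_filter.mpr ⟨Finset.mem_univ _, Equiv.Perm.SameCycle.refl _ _⟩, hb⟩
    ⟨b', fun h => hnot (Finset.mem_filter.mp h).2, hb'⟩

/-- **pure relabel**: in a rigid design, if two dominant terms differ in class at a column fixed by the quotient, that column is their ONLY
difference; in particular two dominant terms with the same permutation differ in at most one cell. [this seat] -/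
theorem eq_of_apply_eq (hrig : ∀ q : Equiv.Perm (Fin m) × (Fin m → Fin K), termSign ε q ≠ 0 → ∃ θ : ℤ, IsDominant d v ε θ q)
    {θ₁ θ₂ : ℤ} {σ₁ σ₂ : Equiv.Perm (Fin m)} {l₁ l₂ : Fin m → Fin K}
    (h₁ : IsDominant d v ε θ₁ (σ₁, l₁)) (h₂ : IsDominant d v ε θ₂ (σ₂, l₂)) {b b' : Fin m} (hfix : σ₁ b = σ₂ b)
    (hb : l₁ b ≠ l₂ b) (hb' : σ₁ b' ≠ σ₂ b' ∨ l₁ b' ≠ l₂ b') : b' = b := by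
  have hsc := sameCycle d v ε hrig h₁ h₂ (Or.inr hb) hb'
  have hfixπ : (σ₁⁻¹ * σ₂) b = b := by
    rw [Equiv.Perm.mul_apply, Equiv.Perm.inv_eq_iff_eq]; exact hfix.symm
  obtain ⟨i, hi⟩ := hsc
  rw [Equiv.Perm.zpow_apply_eq_self_of_apply_eq_self hfixπ] at hi
  exact hi.symm

/-- **same permutation ⇒ one cell**: two dominant terms of a rigid design with the same permutation differ in at most one column's class. [this seat] -/
theorem classes_differ_at_most_once (hrig : ∀ q : Equiv.Perm (Fin m) × (Fin m → Fin K), termSign ε q ≠ 0 → ∃ θ : ℤ, IsDominant d v ε θ q)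
    {θ₁ θ₂ : ℤ} {σ : Equiv.Perm (Fin m)} {l₁ l₂ : Fin m → Fin K}
    (h₁ : IsDominant d v ε θ₁ (σ, l₁)) (h₂ : IsDominant d v ε θ₂ (σ, l₂)) {b b' : Fin m}
    (hb : l₁ b ≠ l₂ b) (hb' : l₁ b' ≠ l₂ b') : b' = b :=
  eq_of_apply_eq d v ε hrig h₁ h₂ rfl hb (Or.inr hb')

end RigidityLaw

end Summit.ValiantsHypothesis.ValiantsHypothesis.Theorems.KPlusLogSqLaw
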